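import Summits.ResolutionOfSingularities.ResolutionOfSingularities.Theorems.AQSHeightTwoSlopeCaseC
import Summits.ResolutionOfSingularities.ResolutionOfSingularities.Theorems.AQSHeightTwoSlopeCompare
import Summits.ResolutionOfSingularities.ResolutionOfSingularities.Theorems.WeightedInvariantHypersurfaceLocalGameEFTDimTwo
import Literature.AlgebraicGeometry.Resolution.HypersurfaceHeightTwoWeightedCentre
import HarnessLib

/-!
# Abramovich–Quek–Schober at a height-two point, IV: the lex-maximal admissible weighted centre germ EXISTS

Topic: `Summits/ResolutionOfSingularities/ResolutionOfSingularities/Theorems`. Helper for the door item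
`HypersurfaceCentreConstruction` (statement `stmt-ResolutionOfSingularities-19897`, route `WeightedInvariant`), line
`local-engine`, ORDER (o25) «F-AQS-T in the kernel» of `res-L1-w43-plan-1` (2026-08-27T09:19:49Z), piece (α4) of
`plan/tools/res-type-092/o25/O25-DESIGN.md` (res-type-092): the LOCAL half of the named fact
`AbramovichQuekSchober2025_heightTwoCentre` — Abramovich–Quek–Schober, arXiv:2507.01232v3, **Thm 1.3 (1) with Thm 3.5**: at a
point of a regular two-dimensional local ring where the hypersurface germ `(f)` is not `(y^ν)` for a regular parameter `y`,
the lex-maximal admissible weighted centre germ `J = (y^{a₁}, x^{a₂})`, `a₁ = ν = ord f`, `a₂ = δν`, EXISTS, is lex-maximal over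
ALL regular systems of parameters and ALL weights, and its Rees filtration is unique — the predicate `IsLexMaxWeightedCentreGerm`
of `Literature/…/HypersurfaceHeightTwoWeightedCentre.lean`, inhabited in the kernel.

[OURS · L1 W4.3] Route (design memo §1): K7's certificate `LocalGameEFTDimTwo.exists_associated_pow_or_terminal` (res-type-098,
p515237; EXCELLENCE enters there, once) decides the three regimes — (B) tangent cone not a rational `ν`-fold line: `δ = 1`,
`J = 𝔪^ν`; (C) prepared at level `b`, not reaching `b+1`: `δ = r/q ∈ (b, b+1)` read on a unit expansion (res-D-pv-023's
`AQSHeightTwoSlope`, p522538, and `AQSHeightTwoSlopeCaseC`); (D) `δ = b ≥ 2`, well-prepared = not steepenable — and the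
comparison lemma `AQSHeightTwo.exists_order_ge` (file II) gives MAXIMALITY and UNIQUENESS in each.  NOT a statement of the
manuscript under review (Hironaka 2017); nothing here is a claim about resolution of singularities.  AI work, weaker than expert
review.  Def-free.

## Main statement

`exists_isLexMaxWeightedCentreGerm`: `S` regular local of Krull dimension `2`, essentially of finite type over a field; `f ≠ 0`
with `(f) ≠ (y^ν)` for every regular parameter `y` and every `ν`.  Then there are a regular system of parameters `(x, y)`, coprime
`1 ≤ q ≤ r` and `ν = ord f ≥ 2` with `IsLexMaxWeightedCentreGerm S (f) ![y, x] ![r, q] (rν)` (AQS index convention: the ORDER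
variable `y` first, `ℓ / w 0 = rν / r = ν`).

## References

* D. Abramovich, M. H. Quek, B. Schober, arXiv:2507.01232v3, Thm 1.3 (1), Def. 3.2–3.3, Thm 3.5 (p. 7 L67–L74, proof p. 8).
  [AbramovichQuekSchober2025]
* H. Hironaka, *Characteristic polyhedra of singularities*, J. Math. Kyoto Univ. 7 (1967). [Hironaka1967]
-/

noncomputable section

open IsLocalRing Literature.AlgebraicGeometry.Resolution

set_option linter.dupNamespace false -- mandated namespace of this single-conjunct summit

namespace Summit.ResolutionOfSingularities.ResolutionOfSingularities.Theorems

namespace AQSHeightTwo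

universe u

variable {S : Type u} [CommRing S]

/-! ### Small bookkeeping -/

/-- A `Fin 2`-family is the vector of its two values. [folklore] -/
theorem vec_two_eq {α : Type u} (v : Fin 2 → α) : v = ![v 0, v 1] := by
  funext i; fin_cases i <;> rfl

/-- `span (range ![a, b]) = span {a, b}`. [folklore] -/
theorem span_range_two (a b : S) : Ideal.span (Set.range ![a, b]) = Ideal.span {a, b} := by
  rw [Matrix.range_cons_cons_empty]

/-- `span {a, b} = span {b, a}`. [folklore] -/
theorem span_pair_comm' (a b : S) : Ideal.span ({a, b} : Set S) = Ideal.span {b, a} := by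
  rw [Set.pair_comm]

section Local

variable [IsLocalRing S]

/-- `𝒥_{bν+1}((x,y);(1,b)) ⊆ 𝔪^{ν+1}` for `b ≥ 1` (every monomial strictly above the `(1,b)`-face has degree `> ν`).
[cite: Wlodarczyk2022, Lemma 2.1.12] -/
theorem weightedMonomialIdeal_succ_le_pow {x y : S} (hx : x ∈ maximalIdeal S) (hy : y ∈ maximalIdeal S) {b : ℕ}
    (hb : 1 ≤ b) (ν : ℕ) : weightedMonomialIdeal ![x, y] ![1, b] (b * ν + 1) ≤ maximalIdeal S ^ (ν + 1) := by
  refine weightedMonomialIdeal_two_le fun i j hij => ?_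
  have hdeg : ν + 1 ≤ i + j := by
    by_cases hj : j ≤ ν
    · have : b * j + b * (ν - j) = b * ν := by rw [← Nat.mul_add, Nat.add_sub_cancel' hj]
      have : 1 * (ν - j) ≤ b * (ν - j) := Nat.mul_le_mul_right _ hb
      omega
    · omega
  have hmem : x ^ i * y ^ j ∈ maximalIdeal S ^ (i + j) := by
    rw [pow_add]; exact Ideal.mul_mem_mul (Ideal.pow_mem_pow hx i) (Ideal.pow_mem_pow hy j)
  exact Ideal.pow_le_pow_right hdeg hmem

/-- **First clause of lex-maximality**: an admissible `(y'; w'; ℓ')` with `w'₁ ≤ w'₀`, `0 < w'₀`, has `ℓ' ≤ ν w'₀`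
(`f ∉ 𝔪^{ν+1}`). [cite: AbramovichQuekSchober2025, Def. 3.2] -/
theorem level_le_of_mem {y₀ y₁ f : S} (hy₀ : y₀ ∈ maximalIdeal S) (hy₁ : y₁ ∈ maximalIdeal S) {ν : ℕ}
    (hford : f ∉ maximalIdeal S ^ (ν + 1)) {w₀ w₁ ℓ : ℕ} (hw : w₁ ≤ w₀)
    (hf : f ∈ weightedMonomialIdeal ![y₀, y₁] ![w₀, w₁] ℓ) : ℓ ≤ ν * w₀ := by
  by_contra h
  push Not at h
  exact hford (le_pow_of_weights_le hy₀ hy₁ le_rfl hw ν (weightedMonomialIdeal_antitone _ _ (by omega) hf))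

end Local

/-! ### The three regimes: no steeper admissible centre -/

section Regimes

variable [IsRegularLocalRing S]

/-- **Regime (B)** (tangent cone not a rational `ν`-fold line): NO regular system carries `f ∉ 𝔪^{ν+1}` at a slope `> 1`.
[cite: AbramovichQuekSchober2025, §2 (δ = 1)] -/
theorem caseB_false_of_steeper {f : S} {ν : ℕ} (hford : f ∉ maximalIdeal S ^ (ν + 1))
    (hB : ¬ ∃ x' y' c : S, Ideal.span {x', y'} = maximalIdeal S ∧ IsUnit c ∧
      f - c * y' ^ ν ∈ weightedMonomialIdeal ![x', y'] ![1, 1] (1 * ν + 1))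
    {x' y' : S} (hxy' : Ideal.span {x', y'} = maximalIdeal S) {q' r' : ℕ} (hlt : q' < r')
    (hf' : f ∈ weightedMonomialIdeal ![x', y'] ![q', r'] (r' * ν)) : False := by
  have hy' : y' ∈ maximalIdeal S := hxy' ▸ Ideal.subset_span (by simp)
  obtain ⟨c, m, hc, hm, hfcm⟩ := exists_unit_mul_pow_add hy' (le_span_pow_sup_pow hxy' hlt ν hf') hford
  refine hB ⟨x', y', c, hxy', hc, ?_⟩
  rw [LocalGameEFTSteepening.weightedMonomialIdeal_one_eq_pow, hxy', one_mul, hfcm, add_sub_cancel_left]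
  exact hm

/-- **Regime (D)** (integer slope `b ≥ 2`, not steepenable): NO regular system carries `f` at a slope `> b`.
[cite: AbramovichQuekSchober2025, Thm 3.5 proof (b)] -/
theorem caseD_false_of_steeper (hdim : ringKrullDim S = (2 : ℕ)) {x y f : S} (hxy : Ideal.span {x, y} = maximalIdeal S)
    {ν : ℕ} (hν : 1 ≤ ν) (hford : f ∉ maximalIdeal S ^ (ν + 1)) {b : ℕ} (hb : 2 ≤ b)
    (hfJ : f ∈ weightedMonomialIdeal ![x, y] ![1, b] (b * ν))
    (hD : ¬ ∃ c lam : S, IsUnit c ∧ f - c * (y - lam * x ^ b) ^ ν ∈ weightedMonomialIdeal ![x, y] ![1, b] (b * ν + 1))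
    {x' y' : S} (hxy' : Ideal.span {x', y'} = maximalIdeal S) {q' r' : ℕ} (hq' : 0 < q') (hlt : b * q' < r')
    (hf' : f ∈ weightedMonomialIdeal ![x', y'] ![q', r'] (r' * ν)) : False := by
  have hx : x ∈ maximalIdeal S := hxy ▸ Ideal.subset_span (by simp)
  have hy : y ∈ maximalIdeal S := hxy ▸ Ideal.subset_span (by simp)
  have hb1 : 1 ≤ b := by omega
  have hlt' : q' < r' := by nlinarith
  -- `y' ∈ (y) + 𝔪^t`, `t ≥ b`, hence `y' = a (y - λ x^b)`
  obtain ⟨t, hbt, hmem⟩ := exists_order_ge hdim hxy hxy' hν hford one_pos hq' hlt' (by nlinarith) hfJ hf'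
  rw [one_mul] at hbt
  obtain ⟨a, lam, ha, hy'eq⟩ := exists_steepen_form_of_le hdim hxy hxy' hb hbt hmem
  -- move `hf'` to the regular system `(x, y - λ x^b)`
  have hpow : x ^ b ∈ maximalIdeal S ^ 2 := Ideal.pow_le_pow_right hb (Ideal.pow_mem_pow hx b)
  have hxay : Ideal.span {x, a * y + -(a * lam * x ^ b)} = maximalIdeal S :=
    span_pair_eq_of_unit_mul_add hxy ha (neg_mem (Ideal.mul_mem_left _ _ hpow))
  have hy'eq' : y' = a * y + -(a * lam * x ^ b) := by rw [hy'eq]; ring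
  have hxy'' : Ideal.span {x, y'} = maximalIdeal S := by rw [hy'eq']; exact hxay
  have h1 : f ∈ weightedMonomialIdeal ![x, y - lam * x ^ b] ![q', r'] (r' * ν) := by
    rw [← eq_of_snd_unit_mul x (y - lam * x ^ b) ha, ← hy'eq, ← eq_of_fst hxy'' hxy' hlt'.le]; exact hf'
  -- read it against the `(1,b)`-face of `(x, y - λ x^b) = (x, y)`
  have h2 := le_span_pow_sup_of_lt x (y - lam * x ^ b) hlt ν h1
  rw [LocalGameEFTSteepening.weightedMonomialIdeal_steepen_eq] at h2
  obtain ⟨cν, hcν, m, hm, hfcm⟩ := Submodule.mem_sup.mp h2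
  obtain ⟨c', rfl⟩ := Ideal.mem_span_singleton'.mp hcν
  have hc' : IsUnit c' := by
    by_contra hcu
    apply hford
    refine weightedMonomialIdeal_succ_le_pow hx hy hb1 ν ?_
    rw [← hfcm]
    refine Ideal.add_mem _ ?_ hm
    -- `c' ∈ 𝔪`: `c' (y - λx^b)^ν ∈ 𝔪 · (y - λx^b)^ν ⊆ 𝒥_{bν+1}`
    have hyb : (y - lam * x ^ b) ∈ weightedMonomialIdeal ![x, y] ![1, b] b := by
      rw [← LocalGameEFTSteepening.weightedMonomialIdeal_steepen_eq x y lam b b]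
      exact LocalGameEFTSteepening.snd_mem x (y - lam * x ^ b) b
    have hybν : (y - lam * x ^ b) ^ ν ∈ weightedMonomialIdeal ![x, y] ![1, b] (b * ν) :=
      pow_mem_weightedMonomialIdeal ![x, y] ![1, b] hyb ν
    have hcm : c' ∈ weightedMonomialIdeal ![x, y] ![1, b] 1 :=
      LocalGameEFTSteepening.span_pair_pow_le x y hb1 1
        (by rw [pow_one, hxy]; exact (IsLocalRing.mem_maximalIdeal _).mpr hcu)
    have := weightedMonomialIdeal_mul_le ![x, y] ![1, b] 1 (b * ν) (Ideal.mul_mem_mul hcm hybν)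
    rwa [Nat.add_comm] at this
  exact hD ⟨c', lam, hc', by rw [← hfcm, add_sub_cancel_left]; exact hm⟩

end Regimes

/-! ### The lex-maximal centre germ -/

section Main

/-- **Abramovich–Quek–Schober, Thm 1.3 (1) with Thm 3.5 — the lex-maximal admissible weighted centre germ EXISTS.**
`S` regular local of Krull dimension `2`, essentially of finite type over a field `k₀` (any characteristic); `f ≠ 0` whose ideal
is not `(y^ν)` for any regular parameter `y` and any `ν` («`C_red` singular»).  Then there are a regular system of parameters
`(x, y)` of `S`, coprime weights `1 ≤ q ≤ r` and `ν = ord f ≥ 2` such that `(y, x; r, q; rν)` is THE lex-maximal admissible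
weighted centre germ of `(f)` — `IsLexMaxWeightedCentreGerm S (f) ![y, x] ![r, q] (rν)`, index `0` = the order variable —
in particular `ℓ / w 0 = ν`. [cite: AbramovichQuekSchober2025, Thm 1.3 (1), Thm 3.5] -/
theorem exists_isLexMaxWeightedCentreGerm (S : Type) [CommRing S] [IsRegularLocalRing S]
    (k₀ : Type) [Field k₀] [Algebra k₀ S] [Algebra.EssFiniteType k₀ S]
    (hdim : ringKrullDim S = 2) (f : S) (hf0 : f ≠ 0)
    (hny : ∀ y : S, y ∈ maximalIdeal S → y ∉ maximalIdeal S ^ 2 → ∀ ν : ℕ, Ideal.span {f} ≠ Ideal.span {y ^ ν}) :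
    ∃ (x y : S) (q r ν : ℕ), 2 ≤ ν ∧ f ∈ maximalIdeal S ^ ν ∧ f ∉ maximalIdeal S ^ (ν + 1) ∧ 0 < q ∧ q ≤ r ∧
      Ideal.span {x, y} = maximalIdeal S ∧
      IsLexMaxWeightedCentreGerm S (Ideal.span {f}) ![y, x] ![r, q] (r * ν) := by
  classical
  haveI := isDomain_of_isRegularLocalRing S
  have hdimN : ringKrullDim S = (2 : ℕ) := LocalGameEFTDimTwo.ringKrullDim_eq_two_nat hdim
  -- `f ∈ 𝔪²`: a unit or a regular parameter would be `(y^0)` / `(y^1)`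
  obtain ⟨x₀, y₀, hxy₀⟩ := LocalGameEFTDimTwo.exists_span_pair_eq_maximalIdeal S hdim
  have hy₀ : y₀ ∈ maximalIdeal S := hxy₀ ▸ Ideal.subset_span (by simp)
  have hy₀2 : y₀ ∉ maximalIdeal S ^ 2 := (LocalGameEFTSteepening.not_mem_sq_of_span_pair_eq hdimN hxy₀).2
  have hf1 : f ∈ maximalIdeal S := by
    by_contra h
    have hu : IsUnit f := by
      by_contra hu
      exact h ((IsLocalRing.mem_maximalIdeal _).mpr hu)
    refine hny y₀ hy₀ hy₀2 0 ?_
    rw [pow_zero, Ideal.span_singleton_one, Ideal.span_singleton_eq_top.mpr hu]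
  have hf2 : f ∈ maximalIdeal S ^ 2 := by
    by_contra h
    exact hny f hf1 h 1 (by rw [pow_one])
  -- K7's certificate
  obtain ⟨ν, hν2, hfν, hfν', -, hA | ⟨x, y, b, hxy, hb, hcert⟩⟩ :=
    LocalGameEFTDimTwo.exists_associated_pow_or_terminal S k₀ hdim f hf0 hf2
  · -- monomial type is excluded by hypothesis
    obtain ⟨π, hπ, hπ2, hass⟩ := hA
    exact absurd (Ideal.span_singleton_eq_span_singleton.mpr hass) (hny π hπ hπ2 ν)
  have hν1 : 1 ≤ ν := by omega
  have hx : x ∈ maximalIdeal S := hxy ▸ Ideal.subset_span (by simp)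
  have hy : y ∈ maximalIdeal S := hxy ▸ Ideal.subset_span (by simp)
  -- the uniform package `(q, r)`: admissible, no steeper regular system, unique filtration
  obtain ⟨q, r, hq, hqr, hcop, hmem, hnosteep, huniq⟩ : ∃ q r : ℕ, 0 < q ∧ q ≤ r ∧ Nat.Coprime q r ∧
      f ∈ weightedMonomialIdeal ![x, y] ![q, r] (r * ν) ∧
      (∀ (x' y' : S) (q' r' : ℕ), Ideal.span {x', y'} = maximalIdeal S → 0 < q' → r * q' < r' * q →
        f ∉ weightedMonomialIdeal ![x', y'] ![q', r'] (r' * ν)) ∧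
      (∀ (x' y' : S), Ideal.span {x', y'} = maximalIdeal S → f ∈ weightedMonomialIdeal ![x', y'] ![q, r] (r * ν) →
        ∀ n, weightedMonomialIdeal ![x', y'] ![q, r] n = weightedMonomialIdeal ![x, y] ![q, r] n) := by
    rcases hcert with ⟨rfl, hB⟩ | ⟨⟨c, hc, hprep⟩, hnot⟩ | ⟨hb2, hfJ, hD⟩
    · -- regime (B): `δ = 1`, `J = 𝔪^ν`
      refine ⟨1, 1, one_pos, le_rfl, Nat.coprime_one_right _, ?_, ?_, ?_⟩
      · rw [LocalGameEFTSteepening.weightedMonomialIdeal_one_eq_pow, hxy, one_mul]; exact hfν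
      · intro x' y' q' r' hxy' hq' hlt hf'
        rw [Nat.one_mul, Nat.mul_one] at hlt
        exact caseB_false_of_steeper hfν' hB hxy' hlt hf'
      · intro x' y' hxy' _ n
        rw [LocalGameEFTSteepening.weightedMonomialIdeal_one_eq_pow, hxy',
          LocalGameEFTSteepening.weightedMonomialIdeal_one_eq_pow, hxy]
    · -- regime (C): `δ = r/q ∈ (b, b+1)`
      obtain ⟨q, r, hq, hbq, hrq, hcop, hmem, hmax, -⟩ := exists_slope hdimN hxy hb hfν hfν' hc hprep hnot
      have hqr : q < r := lt_of_le_of_lt (Nat.le_mul_of_pos_left q hb) hbq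
      have hndvd : ¬ q ∣ r := by
        rintro ⟨k, rfl⟩
        have h1' : q * b < q * k := by rw [Nat.mul_comm q b]; exact hbq
        have h1 : b < k := Nat.lt_of_mul_lt_mul_left h1'
        have h2' : q * k < q * (b + 1) := by rw [Nat.mul_comm q (b + 1)]; exact hrq
        have h2 : k < b + 1 := Nat.lt_of_mul_lt_mul_left h2'
        omega
      refine ⟨q, r, hq, hqr.le, hcop, hmem, ?_, ?_⟩
      · intro x' y' q' r' hxy' hq' hlt hf'
        obtain ⟨q'', r'', hq'', hlt'', -, hf''⟩ :=
          exists_steeper_of_not_dvd hdimN hxy hxy' hν1 hfν' hq hqr hndvd hq' hlt hmem hf'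
        exact hmax q'' r'' hq'' hlt'' hf''
      · intro x' y' hxy' hf' n
        exact filtration_eq_of_mem_of_mem hdimN hxy hxy' hν1 hfν' hq hqr hmem hf' n
    · -- regime (D): `δ = b ≥ 2`
      refine ⟨1, b, one_pos, by omega, Nat.coprime_one_left _, hfJ, ?_, ?_⟩
      · intro x' y' q' r' hxy' hq' hlt hf'
        rw [Nat.mul_one] at hlt
        exact caseD_false_of_steeper hdimN hxy hν1 hfν' hb2 hfJ hD hxy' hq' hlt hf'
      · intro x' y' hxy' hf' n
        exact filtration_eq_of_mem_of_mem hdimN hxy hxy' hν1 hfν' one_pos (by omega) hfJ hf' n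
  have hr0 : 0 < r := lt_of_lt_of_le hq hqr
  refine ⟨x, y, q, r, ν, hν2, hfν, hfν', hq, hqr, hxy, ?_⟩
  -- the predicate, clause by clause
  refine ⟨?_, ?_, ?_, ?_, ?_, ?_, ?_, ?_, ?_⟩
  · rw [span_range_two, span_pair_comm', hxy]
  · exact Fin.forall_fin_two.2 ⟨by simpa using hr0, by simpa using hq⟩
  · simpa using hcop.symm
  · simpa using hqr
  · exact Nat.mul_pos hr0 (by omega)
  · exact ⟨ν, rfl⟩
  · rw [Ideal.span_singleton_le_iff_mem, weightedMonomialIdeal_swap]; exact hmem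
  · -- LEX-MAXIMALITY
    intro y' w' ℓ' hy' hw'pos hw'le hℓ' hI
    have hy'eq := vec_two_eq y'
    have hw'eq := vec_two_eq w'
    rw [hy'eq, span_range_two] at hy'
    have hy'0 : y' 0 ∈ maximalIdeal S := hy' ▸ Ideal.subset_span (by simp)
    have hy'1 : y' 1 ∈ maximalIdeal S := hy' ▸ Ideal.subset_span (by simp)
    have hfI : f ∈ weightedMonomialIdeal ![y' 0, y' 1] ![w' 0, w' 1] ℓ' := by
      rw [← hy'eq, ← hw'eq]; exact hI (Ideal.mem_span_singleton_self f)
    have hℓle : ℓ' ≤ ν * w' 0 := level_le_of_mem hy'0 hy'1 hfν' hw'le hfI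
    simp only [Matrix.cons_val_zero, Matrix.cons_val_one]
    rcases hℓle.lt_or_eq with hlt | heq
    · left
      calc ℓ' * r < ν * w' 0 * r := Nat.mul_lt_mul_of_pos_right hlt hr0
        _ = r * ν * w' 0 := by ring
    · right
      refine ⟨by rw [heq]; ring, ?_⟩
      -- `ν w'₀ q ≤ r ν w'₁`, i.e. the slope `w'₀/w'₁` is at most `r/q`: otherwise a steeper regular system
      by_contra hgt
      push Not at hgt
      rw [heq] at hgt
      have hst : r * w' 1 < w' 0 * q := by
        have : ν * (r * w' 1) < ν * (w' 0 * q) := by nlinarith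
        exact Nat.lt_of_mul_lt_mul_left this
      have hx'y' : Ideal.span {y' 1, y' 0} = maximalIdeal S := by rw [span_pair_comm']; exact hy'
      have hf' : f ∈ weightedMonomialIdeal ![y' 1, y' 0] ![w' 1, w' 0] (w' 0 * ν) := by
        rw [← weightedMonomialIdeal_swap, Nat.mul_comm, ← heq]; exact hfI
      exact hnosteep (y' 1) (y' 0) (w' 1) (w' 0) hx'y' (hw'pos 1) hst hf'
  · -- UNIQUENESS of the Rees filtration
    intro y'' hy'' hI n
    have hy''eq := vec_two_eq y''
    rw [hy''eq, span_range_two] at hy''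
    have hx''y'' : Ideal.span {y'' 1, y'' 0} = maximalIdeal S := by rw [span_pair_comm']; exact hy''
    have hf'' : f ∈ weightedMonomialIdeal ![y'' 1, y'' 0] ![q, r] (r * ν) := by
      rw [← weightedMonomialIdeal_swap, ← hy''eq]; exact hI (Ideal.mem_span_singleton_self f)
    rw [hy''eq, weightedMonomialIdeal_swap (y'' 0) (y'' 1), weightedMonomialIdeal_swap y x]
    exact huniq (y'' 1) (y'' 0) hx''y'' hf'' n

end Main

end AQSHeightTwo

end Summit.ResolutionOfSingularities.ResolutionOfSingularities.Theorems

end
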